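import Summits.QuantumFields.YangMills.Theorems.PoincareLipschitzHistoryTailOfImprove
import Summits.QuantumFields.YangMills.Theorems.PoincareLipschitzImproveOfCore
import Summits.QuantumFields.YangMills.Theorems.PoincareLipschitzImproveCoreOfFlat
import Summits.QuantumFields.YangMills.Theorems.PoincareLipschitzHistoryTailOfVarianceBound
import HarnessLib

/-!
# Crux `HistoryTailL` (stmt-QuantumFields-19936) BY NAME, modulo {K1 (exponential OR Poincaré), the TWIST-FREE organ `hImproveCoreFlat`, `MeanDeviationL`} —
# FILE K-5c: the K2 display v3

Cell `ym3-torus` (YM ladder rung R3 = continuum SU(2) Yang–Mills on T³ — a RUNG, NOT the Clay problem: not d = 4, not infinite volume, not a mass gap);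
LEAD seat `ym-ust-19936-w1` g9 (RULING g9-8 «the organ of record after K-4∕K-5 := hImproveCoreFlat»).  Helper `--supports stmt-QuantumFields-19936`;
THEOREMS ONLY; two one-line compositions over landed files: the display v2 ✓p708615 `historyTailL_of_hImprove` (this seat) resp. ★w3 g13's
✓p702925 `historyTailL_of_varianceBound`, ★w2 g12's K-4 ✓`PoincareLipschitzImproveOfCore.hImprove_of_core` (`hImprove v1 ⟸ hImproveCore`, the
[C]-socket discharged log-free by ★w5's ✓p706915) and this seat's K-5 ✓p709591 `hImproveCore_of_flat` (`hImproveCore ⟸ hImproveCoreFlat`) ∘ K-3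
✓p707954 `blockLipschitzL_of_hImprove`.  THE DISPLAYED ORGAN `hImproveCoreFlat` (FROZEN v1, HOME `ym-ust-19936-w1/g9/FROZEN-hImproveCoreFlat-v1.w1g9.lean.txt`,
sha16 bac8eda30a54887f): «a unit `ℝ⁴`-valued lattice map on `ℤ³` that ALMOST minimises the flat Dirichlet energy in every sub-box `Q_{ρ+1}(z′) ⊆ Q_R(z)`
(slack `δ·(ρ+1)`, `δ` the organ's choice AFTER `ε₁` — the quantifier order is the content, w8 g7 08:25Z) and has bounded normalised energy `E(Q_R(z)) ≤ Λ₀R`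
has normalised energy `≤ ε₁` at ONE comparable scale `r ∈ [R∕C₀, R∕4]` about the centre» — the compactness content of Schoen–Uhlenbeck 1984 (`d(3) = 3`) +
Luckhaus for almost-minimisers `B³ → S³`, transferred to the lattice; NOT in print (roads: ★w3 BLUEPRINT, w8 LOCATE v1.8 R1).  NOTHING of it, of K1, or of
`MeanDeviationL` (stmt-QuantumFields-23083) is proved here; `HistoryTailL` is NOT proved.

WHAT IS PROVED (ns `…Theorems.PoincareLipschitzHistoryTailOfImproveCoreFlat`).
* ★★★ `historyTailL_of_hImproveCoreFlat (hK1 : ⟨K1-exp, ✓p700135's binder VERBATIM⟩) (hF : ⟨hImproveCoreFlat v1 VERBATIM⟩) (hM : MeanDeviationL) : UnitScaleTilt.HistoryTailL`.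
* ★★★ `historyTailL_of_poincare_of_hImproveCoreFlat (hVar : ⟨Poincaré for `gibbsK` at the Hodge–Poincaré scale, ✓p702925's binder VERBATIM⟩) (hF) (hM) : HistoryTailL`.
HONEST SCOPE.  One-liners; YM₃ on T³ is rung R3, not Clay; YM gap NOT proved.

References: T. Bałaban, CMP 102 (1985) 255–275 [Balaban1985UV3] ((71) p.273); R. Schoen, K. Uhlenbeck, J. Diff. Geom. 17 (1982) 307–335 [SchoenUhlenbeck1982]
(§2, §4); D. Bakry, I. Gentil, M. Ledoux, Analysis and Geometry of Markov Diffusion Operators (2014) [BakryGentilLedoux2014] (Prop. 4.4.2).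
-/

set_option autoImplicit false

noncomputable section

namespace Summit.QuantumFields.YangMills.Theorems.PoincareLipschitzHistoryTailOfImproveCoreFlat

open MeasureTheory
open scoped BigOperators
open Literature.MathematicalPhysics.QuantumFieldTheory.Balaban1983to89
open Literature.MathematicalPhysics.QuantumFieldTheory.Balaban1983to89.T3ContinuumYM3Torus
open Literature.MathematicalPhysics.QuantumFieldTheory.Balaban1983to89.T3UnitScaleTilt
open Literature.MathematicalPhysics.QuantumFieldTheory.Balaban1983to89.T3UnitLawDensityEML (ℰp)
open B4Eq19LatticeOperators (Zd box unitVec)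
open Summit.QuantumFields.YangMills.Theorems.PoincareLipschitzHistoryTailOfImprove (historyTailL_of_hImprove)
open Summit.QuantumFields.YangMills.Theorems.PoincareLipschitzHistoryTailOfVarianceBound (historyTailL_of_varianceBound)
open Summit.QuantumFields.YangMills.Theorems.PoincareLipschitzOrbitMinHolderRegularityOfImprove (blockLipschitzL_of_hImprove)
open Summit.QuantumFields.YangMills.Theorems.PoincareLipschitzImproveOfCore (hImprove_of_core)
open Summit.QuantumFields.YangMills.Theorems.PoincareLipschitzImproveCoreOfFlat (hImproveCore_of_flat)

/-- ★★★ **THE CRUX BY NAME FROM K1-exp, THE TWIST-FREE ORGAN, AND `MeanDeviationL`** (display v3, exponential K1 row). [cite: Balaban1985UV3, (71) p.273; SchoenUhlenbeck1982, §4] -/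
theorem historyTailL_of_hImproveCoreFlat
    (hK1 : ∀ (L : ℕ), ∃ (Cc cc : ℝ), 0 ≤ Cc ∧ 0 < cc ∧ ∃ γ₁ : ℝ, 0 < γ₁ ∧ γ₁ ≤ 1 ∧
      ∀ (F : T3Family) (γ : ℝ), F.L = L → 0 < γ → γ ≤ γ₁ → ∀ (K n : ℕ), 1 ≤ n →
        (n : ℝ) ≤ (F.scheme ℰp γ).β K → 2 * n ≤ (F.P K).sitesPerDir 0 →
        ∀ (x₀ : Site (F.P K) 0) (f : GaugeField (F.P K) 0 (Matrix.specialUnitaryGroup (Fin 2) ℂ) → ℝ) (Λ : ℝ), 0 < Λ →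
          Measurable f → GaugeField.GaugeInvariant f →
          (∀ U U' : GaugeField (F.P K) 0 (Matrix.specialUnitaryGroup (Fin 2) ℂ),
            (∀ b : PBond (F.P K) 0, (∀ k, (b.src k - x₀ k).val < n) → (∀ k, (b.tgt k - x₀ k).val < n) → U b = U' b) →
              f U = f U') →
          (∀ U U' : GaugeField (F.P K) 0 (Matrix.specialUnitaryGroup (Fin 2) ℂ),
            |f U - f U'| ≤ Λ * Real.sqrt (∑ b : PBond (F.P K) 0, GaugeGroup.dist1 (U b * (U' b)⁻¹) ^ 2)) →
          ∀ r : ℝ, 0 ≤ r →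
            (gibbsK F ℰp γ K).real {U | r ≤ f U - ∫ V, f V ∂(gibbsK F ℰp γ K)} ≤
              Cc * Real.exp (-(cc * Real.sqrt ((F.scheme ℰp γ).β K) * r / ((n : ℝ) * Λ))))
    (hF : ∀ (Λ₀ ε₁ : ℝ), 0 < Λ₀ → 0 < ε₁ →
      ∃ (δ C₀ R₀ : ℝ), 0 < δ ∧ 1 ≤ C₀ ∧ 1 ≤ R₀ ∧
      ∀ (u : Zd 3 → EuclideanSpace ℝ (Fin 4)) (z : Zd 3) (R : ℤ),
      R₀ ≤ R →
      (∀ y, ‖u y‖ = 1) →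
      (∀ (z' : Zd 3) (ρ : ℤ), 0 ≤ ρ → box z' (ρ + 1) ⊆ box z R →
      ∀ v : Zd 3 → EuclideanSpace ℝ (Fin 4), (∀ y, y ∉ box z' ρ → v y = u y) → (∀ y ∈ box z' ρ, ‖v y‖ = 1) →
      ∑ y ∈ box z' (ρ + 1), ∑ μ : Fin 3, ‖u (y + unitVec μ) - u y‖ ^ 2 ≤
      (∑ y ∈ box z' (ρ + 1), ∑ μ : Fin 3, ‖v (y + unitVec μ) - v y‖ ^ 2) + δ * ((ρ : ℝ) + 1)) →
      (∑ y ∈ box z R, ∑ μ : Fin 3, ‖u (y + unitVec μ) - u y‖ ^ 2 ≤ Λ₀ * R) →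
      ∃ r : ℤ, 1 ≤ r ∧ (R : ℝ) ≤ C₀ * r ∧ 4 * r ≤ R ∧
      ∑ y ∈ box z (2 * r), ∑ μ : Fin 3, ‖u (y + unitVec μ) - u y‖ ^ 2 ≤ ε₁ * r)
    (hM : Summit.QuantumFields.YangMills.Theses.PoincareLipschitz.MeanDeviationL) :
    Summit.QuantumFields.YangMills.Theses.UnitScaleTilt.HistoryTailL :=
  historyTailL_of_hImprove hK1 (hImprove_of_core (hImproveCore_of_flat hF)) hM

/-- ★★★ **THE CRUX BY NAME FROM THE POINCARÉ INEQUALITY FOR `gibbsK`, THE TWIST-FREE ORGAN, AND `MeanDeviationL`** (display v3, Poincaré K1 row —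
★w3 g13's ✓p702925 door). [cite: BakryGentilLedoux2014, Prop. 4.4.2; Balaban1985UV3, (71) p.273; SchoenUhlenbeck1982, §4] -/
theorem historyTailL_of_poincare_of_hImproveCoreFlat
    (hVar : ∀ (L : ℕ), ∃ cV : ℝ, 0 < cV ∧ ∃ γ₁ : ℝ, 0 < γ₁ ∧ γ₁ ≤ 1 ∧
      ∀ (F : T3Family) (γ : ℝ), F.L = L → 0 < γ → γ ≤ γ₁ → ∀ (K n : ℕ), 1 ≤ n →
        (n : ℝ) ≤ (F.scheme ℰp γ).β K → 2 * n ≤ (F.P K).sitesPerDir 0 →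
        ∀ (x₀ : Site (F.P K) 0) (f : GaugeField (F.P K) 0 (Matrix.specialUnitaryGroup (Fin 2) ℂ) → ℝ) (Λ : ℝ), 0 < Λ →
          Measurable f → GaugeField.GaugeInvariant f →
          (∀ U U' : GaugeField (F.P K) 0 (Matrix.specialUnitaryGroup (Fin 2) ℂ),
            (∀ b : PBond (F.P K) 0, (∀ k, (b.src k - x₀ k).val < n) → (∀ k, (b.tgt k - x₀ k).val < n) → U b = U' b) →
              f U = f U') →
          (∀ U U' : GaugeField (F.P K) 0 (Matrix.specialUnitaryGroup (Fin 2) ℂ),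
            |f U - f U'| ≤ Λ * Real.sqrt (∑ b : PBond (F.P K) 0, GaugeGroup.dist1 (U b * (U' b)⁻¹) ^ 2)) →
          ∀ l : ℝ,
            ∫ U, Real.exp (l * f U) ∂(gibbsK F ℰp γ K) - (∫ U, Real.exp (l / 2 * f U) ∂(gibbsK F ℰp γ K)) ^ 2 ≤
              cV * ((n : ℝ) ^ 2 * Λ ^ 2 / (F.scheme ℰp γ).β K) * l ^ 2 * ∫ U, Real.exp (l * f U) ∂(gibbsK F ℰp γ K))
    (hF : ∀ (Λ₀ ε₁ : ℝ), 0 < Λ₀ → 0 < ε₁ →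
      ∃ (δ C₀ R₀ : ℝ), 0 < δ ∧ 1 ≤ C₀ ∧ 1 ≤ R₀ ∧
      ∀ (u : Zd 3 → EuclideanSpace ℝ (Fin 4)) (z : Zd 3) (R : ℤ),
      R₀ ≤ R →
      (∀ y, ‖u y‖ = 1) →
      (∀ (z' : Zd 3) (ρ : ℤ), 0 ≤ ρ → box z' (ρ + 1) ⊆ box z R →
      ∀ v : Zd 3 → EuclideanSpace ℝ (Fin 4), (∀ y, y ∉ box z' ρ → v y = u y) → (∀ y ∈ box z' ρ, ‖v y‖ = 1) →
      ∑ y ∈ box z' (ρ + 1), ∑ μ : Fin 3, ‖u (y + unitVec μ) - u y‖ ^ 2 ≤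
      (∑ y ∈ box z' (ρ + 1), ∑ μ : Fin 3, ‖v (y + unitVec μ) - v y‖ ^ 2) + δ * ((ρ : ℝ) + 1)) →
      (∑ y ∈ box z R, ∑ μ : Fin 3, ‖u (y + unitVec μ) - u y‖ ^ 2 ≤ Λ₀ * R) →
      ∃ r : ℤ, 1 ≤ r ∧ (R : ℝ) ≤ C₀ * r ∧ 4 * r ≤ R ∧
      ∑ y ∈ box z (2 * r), ∑ μ : Fin 3, ‖u (y + unitVec μ) - u y‖ ^ 2 ≤ ε₁ * r)
    (hM : Summit.QuantumFields.YangMills.Theses.PoincareLipschitz.MeanDeviationL) :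
    Summit.QuantumFields.YangMills.Theses.UnitScaleTilt.HistoryTailL :=
  historyTailL_of_varianceBound hVar (blockLipschitzL_of_hImprove (hImprove_of_core (hImproveCore_of_flat hF))) hM

end Summit.QuantumFields.YangMills.Theorems.PoincareLipschitzHistoryTailOfImproveCoreFlat

end
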